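import Summits.RiemannHypothesis.RiemannHypothesis.Theorems.TiltedLandingLaw421R3Lens1PinningTol

/-! # trkD_v14q′ — DRAWER r1 (tenure g20; HELD, UNFILED; import-only against the LANDED «Lens1PinningTol» (token 105); director (CA923)(3)(4), (CA931)).
FOUR stubs on ONE shared θ₀ (provisional 1/10 per (CA923)(1), final after C6's bench; the file regenerates for any 0 ≤ θ₀ < 1); `_of` sorry-free ⊢ the crux BY NAME.
Stub 1′ `TopPinningTol θ₀` replaces v13q's `TopPinning` (CAND 4 / NEG 16); stub 2′ `RegUmbrellaLowS θ₀` is the new SUCC residual it costs; stub 2 verbatim;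
stub 3 = the κ-free ½-purse RATE target by name (replaces v13q's two CreditBooks stubs, NEG 15 / CAND 1).  NOT a registration: registering is the operator's,
on the director's ONE line to PRIMARY.  Nothing here bears on the truth of RH; RH is not proved; ⟨33346⟩/⟨33347⟩ OPEN. -/
namespace Summit.RiemannHypothesis.RiemannHypothesis.Cruxes.TiltedLandingLaw421R.TrkDV14qP

/-- stub 1′ (SUCC, repaired per (CA920)(2)/(CA923)): top-of-cluster pinning with height tolerance θ₀ = 1/10. -/
theorem stub_topPinningTol : RhW08.Lens1PinningTol.TopPinningTol (1 / 10) := by sorry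

/-- stub 2 (SUCC residual, v13q stub 2 VERBATIM): the strictly-taller umbrella. -/
theorem stub_regUmbrella11S : RhW08.Lens1Pinning.RegUmbrella11S := by sorry

/-- stub 2′ (SUCC residual, NEW, same θ₀): the low umbrella — a pinned out-of-band toucher within the tolerance ⇒ successor. -/
theorem stub_regUmbrellaLowS : RhW08.Lens1PinningTol.RegUmbrellaLowS (1 / 10) := by sorry

/-- stub 3 (RATE at the ½-purse, v14q r0 stub 3 VERBATIM). -/
theorem stub_restRateBotHalf : RhW08.PurseP.RestRateBotPQ RhW08.PurseP.halfPurse := by sorry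

/-- COMPOSITION (sorry-free, concludes the crux BY NAME). -/
theorem TiltedLandingLaw421R_of :
    Summit.RiemannHypothesis.RiemannHypothesis.Theses.EarlyAppointments.TiltedLandingLaw421R :=
  RhW08.PurseP.law421Half_of_succ_rate
    (RhW08.Lens1Coverage.restSuccBotQ_of_resS (RhW08.Lens1Coverage.regRes8S_of_regHungCut10S
      (RhW08.Lens1PinningTol.regHungCut10S_of_topPinningTol stub_topPinningTol stub_regUmbrella11S stub_regUmbrellaLowS)))
    stub_restRateBotHalf

end Summit.RiemannHypothesis.RiemannHypothesis.Cruxes.TiltedLandingLaw421R.TrkDV14qP
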